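import Literature.MathematicalPhysics.QuantumManyBody.SwapPurity
import Summits.AtomisticToContinuum.BoseEinsteinCondensation.Statement

/-!
# Conditional confinement bounds `λ_max(γ_Ψ)`: rigidity excludes BEC

Conjunct `BoseEinsteinCondensation` of `AtomisticToContinuum`. Write `Z = x :: X̂ ∈ (ℝ³)^{n+1}`,
`N = n + 1`, `m_Ψ(X̂) = ∫ |Ψ(x, X̂)|² dx` (the marginal density of the other `n` particles) and, for a
set `S ⊆ ℝ³ × (ℝ³)ⁿ` of "allowed positions of one particle given the others",

  `π_S(x) = ∫ 1_S(x, X̂) m_Ψ(X̂) dX̂ = P_{X̂ ∼ m_Ψ}[(x, X̂) ∈ S]`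

(the probability, under the law of the remaining particles, that the position `x` is allowed).
If `Ψ` is *conditionally confined* by `S` — `Ψ(x, X̂) = 0` whenever `(x, X̂) ∉ S` — then for every
one-particle mode `φ`

  `⟨φ, γ_Ψ φ⟩ ≤ N ∫ |φ(x)|² π_S(x) dx ≤ N · sup_x π_S(x)`           (`SoloInformed.occupation_le_of_confined`)

hence `λ_max(γ_Ψ) ≤ N sup_x π_S(x)` (`SoloInformed.maxOccupation_le_of_confined`), and the same bound
passes to the ground-state condensate number when near-minimisers are confined
(`SoloInformed.condensateNumber_le_of_confined`; asymptotically, allowance `p_N → 0` gives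
`¬ HasGroundStateBEC v ρ`, `SoloInformed.not_hasGroundStateBEC_of_confined`). Proof: Cauchy–Schwarz in the variable `x` on the
slice `S(·, X̂)` only, `|∫ conj φ Ψ(·, X̂)|² ≤ (∫_{S(·,X̂)} |φ|²) m_Ψ(X̂)`, then Tonelli.

Reading (point-process language; this is the finite-`N` form of *number rigidity* in the sense of
Ghosh–Peres, arXiv:1211.2381, turned into an obstruction to off-diagonal long-range order): if the
positions of the other particles determine a region of volume fraction `≤ p` in which the remaining
particle must lie, uniformly, then `λ_max ≤ p N`. The bound is sharp on number-fragmented states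
(`M` disjoint cells holding prescribed particle numbers `n₁, …, n_M`: given `X̂` the deficient cell is
determined, `π_S(x) = n_{j(x)}/N`, so `λ_max ≤ max_j n_j`, which is the exact value), and it is the
mechanism behind the absence of BEC in crystalline (each particle caged by its neighbours) states. It
complements the cat-state witnesses of `Literature/…/BoseGasCatStates` (superposed, not number-
fragmented) and is, to our knowledge, not stated in this form in print ([folklore] Cauchy–Schwarz;
the rigidity ↔ no-ODLRO link is the content). A proof of the conjunct must therefore show that the
dilute 3-D ground state is *quantitatively non-rigid* (deletion tolerant) uniformly in the volume —
see the accompanying report `paper/sharpest.md` of the soloist seat for the entropic form of this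
requirement.
-/

noncomputable section

open MeasureTheory Filter Set
open scoped ENNReal NNReal ComplexConjugate

namespace Summit.AtomisticToContinuum.BoseEinsteinCondensation.Theorems

open Literature.MathematicalPhysics.QuantumManyBody.BoseGas

variable {n : ℕ}

/-- The `0/1`-indicator is idempotent under squaring. [folklore] -/
theorem SoloInformed.indicator_one_sq {α : Type*} (S : Set α) (a : α) :
    (S.indicator (1 : α → ℝ≥0∞) a) ^ 2 = S.indicator 1 a := by
  by_cases ha : a ∈ S <;> simp [ha]

/-- `x ↦ 1_S(x, X̂)` is measurable for measurable `S`. [folklore] -/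
theorem SoloInformed.measurable_indicator_slice {S : Set (Space × Config n)} (hS : MeasurableSet S)
    (Y : Config n) : Measurable fun x : Space => S.indicator (1 : Space × Config n → ℝ≥0∞) (x, Y) :=
  (measurable_const.indicator hS).comp (measurable_id.prodMk measurable_const)

/-- **Cauchy–Schwarz on the allowed slice.** If `Ψ(x, X̂) = 0` off `S`, then for every mode `φ` and
every `X̂`: `|∫ conj φ(x) Ψ(x, X̂) dx|² ≤ (∫ 1_S(x, X̂) |φ(x)|² dx) · ∫ |Ψ(x, X̂)|² dx`. [folklore] -/
theorem SoloInformed.sq_nnnorm_integral_le_of_confined {Ψ : Config (n + 1) → ℂ} (hΨ : Measurable Ψ)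
    {S : Set (Space × Config n)} (hS : MeasurableSet S)
    (h0 : ∀ x Y, (x, Y) ∉ S → Ψ (Matrix.vecCons x Y) = 0)
    {φ : Space → ℂ} (hφ : AEStronglyMeasurable φ volume) (Y : Config n) :
    (‖∫ x, conj (φ x) * Ψ (Matrix.vecCons x Y)‖₊ : ℝ≥0∞) ^ 2 ≤
      (∫⁻ x, S.indicator (1 : Space × Config n → ℝ≥0∞) (x, Y) * (‖φ x‖₊ : ℝ≥0∞) ^ 2) *
        ∫⁻ x, (‖Ψ (Matrix.vecCons x Y)‖₊ : ℝ≥0∞) ^ 2 := by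
  have hf : AEMeasurable (fun x => S.indicator (1 : Space × Config n → ℝ≥0∞) (x, Y) *
      (‖φ x‖₊ : ℝ≥0∞)) volume :=
    (SoloInformed.measurable_indicator_slice hS Y).aemeasurable.mul
      hφ.aemeasurable.nnnorm.coe_nnreal_ennreal
  have hg : AEMeasurable (fun x => (‖Ψ (Matrix.vecCons x Y)‖₊ : ℝ≥0∞)) volume :=
    (measurable_comp_vecCons_left hΨ Y).aemeasurable.nnnorm.coe_nnreal_ennreal
  calc (‖∫ x, conj (φ x) * Ψ (Matrix.vecCons x Y)‖₊ : ℝ≥0∞) ^ 2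
      ≤ (∫⁻ x, (‖conj (φ x) * Ψ (Matrix.vecCons x Y)‖₊ : ℝ≥0∞)) ^ 2 := by
        gcongr
        exact enorm_integral_le_lintegral_enorm _
    _ = (∫⁻ x, (S.indicator (1 : Space × Config n → ℝ≥0∞) (x, Y) * (‖φ x‖₊ : ℝ≥0∞)) *
          (‖Ψ (Matrix.vecCons x Y)‖₊ : ℝ≥0∞)) ^ 2 := by
        congr 1
        refine lintegral_congr fun x => ?_
        rw [nnnorm_mul, ENNReal.coe_mul, RCLike.nnnorm_conj]
        by_cases hx : (x, Y) ∈ S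
        · simp [hx]
        · simp [h0 x Y hx]
    _ ≤ (∫⁻ x, (S.indicator (1 : Space × Config n → ℝ≥0∞) (x, Y) * (‖φ x‖₊ : ℝ≥0∞)) ^ 2) *
          ∫⁻ x, (‖Ψ (Matrix.vecCons x Y)‖₊ : ℝ≥0∞) ^ 2 := lintegral_mul_sq_le volume hf hg
    _ = _ := by
        congr 1
        refine lintegral_congr fun x => ?_
        rw [mul_pow, SoloInformed.indicator_one_sq]

/-- **Occupation under conditional confinement.** If `Ψ(x, X̂) = 0` whenever `(x, X̂) ∉ S`, then for
every mode `φ`: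
`⟨φ, γ_Ψ φ⟩ ≤ N ∫ |φ(x)|² π_S(x) dx`, `π_S(x) = ∫ 1_S(x, X̂) (∫ |Ψ(x', X̂)|² dx') dX̂`
(Cauchy–Schwarz on the allowed slice, then Tonelli). [folklore] -/
theorem SoloInformed.occupation_le_of_confined {Ψ : Config (n + 1) → ℂ} (hΨ : Measurable Ψ)
    {S : Set (Space × Config n)} (hS : MeasurableSet S)
    (h0 : ∀ x Y, (x, Y) ∉ S → Ψ (Matrix.vecCons x Y) = 0)
    {φ : Space → ℂ} (hφ : AEStronglyMeasurable φ volume) :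
    occupation (n + 1) φ Ψ ≤ (n + 1 : ℝ≥0∞) *
      ∫⁻ x, (‖φ x‖₊ : ℝ≥0∞) ^ 2 *
        ∫⁻ Y : Config n, S.indicator (1 : Space × Config n → ℝ≥0∞) (x, Y) *
          ∫⁻ x', (‖Ψ (Matrix.vecCons x' Y)‖₊ : ℝ≥0∞) ^ 2 := by
  set m : Config n → ℝ≥0∞ := fun Y => ∫⁻ x', (‖Ψ (Matrix.vecCons x' Y)‖₊ : ℝ≥0∞) ^ 2 with hm
  have hmm : Measurable m := measurable_lintegral_sq_nnnorm_vecCons hΨ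
  have hind : Measurable (S.indicator (1 : Space × Config n → ℝ≥0∞)) :=
    measurable_const.indicator hS
  have hφ2 : AEMeasurable (fun x => (‖φ x‖₊ : ℝ≥0∞) ^ 2) volume :=
    hφ.aemeasurable.nnnorm.coe_nnreal_ennreal.pow_const 2
  -- the integrand of the double integral, as a function of `(Y, x)`
  have hF : AEMeasurable (Function.uncurry fun (Y : Config n) (x : Space) =>
      S.indicator (1 : Space × Config n → ℝ≥0∞) (x, Y) * (‖φ x‖₊ : ℝ≥0∞) ^ 2 * m Y)
      ((volume : Measure (Config n)).prod (volume : Measure Space)) := by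
    refine AEMeasurable.mul (AEMeasurable.mul ?_ hφ2.comp_snd) (hmm.comp measurable_fst).aemeasurable
    exact (hind.comp measurable_swap).aemeasurable
  rw [occupation]
  gcongr
  calc ∫⁻ Y, (‖∫ x, conj (φ x) * Ψ (Matrix.vecCons x Y)‖₊ : ℝ≥0∞) ^ 2
      ≤ ∫⁻ Y, (∫⁻ x, S.indicator (1 : Space × Config n → ℝ≥0∞) (x, Y) * (‖φ x‖₊ : ℝ≥0∞) ^ 2) *
          m Y :=
        lintegral_mono fun Y => SoloInformed.sq_nnnorm_integral_le_of_confined hΨ hS h0 hφ Y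
    _ = ∫⁻ Y, ∫⁻ x, S.indicator (1 : Space × Config n → ℝ≥0∞) (x, Y) * (‖φ x‖₊ : ℝ≥0∞) ^ 2 *
          m Y := by
        refine lintegral_congr fun Y => ?_
        have hf : AEMeasurable (fun x => S.indicator (1 : Space × Config n → ℝ≥0∞) (x, Y) *
            (‖φ x‖₊ : ℝ≥0∞) ^ 2) volume :=
          (SoloInformed.measurable_indicator_slice hS Y).aemeasurable.mul hφ2
        rw [lintegral_mul_const'' (m Y) hf]
    _ = ∫⁻ x, ∫⁻ Y, S.indicator (1 : Space × Config n → ℝ≥0∞) (x, Y) * (‖φ x‖₊ : ℝ≥0∞) ^ 2 *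
          m Y := lintegral_lintegral_swap hF
    _ = ∫⁻ x, (‖φ x‖₊ : ℝ≥0∞) ^ 2 *
          ∫⁻ Y, S.indicator (1 : Space × Config n → ℝ≥0∞) (x, Y) * m Y := by
        refine lintegral_congr fun x => ?_
        have hG : Measurable (fun Y : Config n =>
            S.indicator (1 : Space × Config n → ℝ≥0∞) (x, Y) * m Y) :=
          (hind.comp (measurable_const.prodMk measurable_id)).mul hmm
        rw [← lintegral_const_mul ((‖φ x‖₊ : ℝ≥0∞) ^ 2) hG]
        refine lintegral_congr fun Y => ?_
        ring

/-- **Rigidity bounds `λ_max`.** If `Ψ(x, X̂) = 0` whenever `(x, X̂) ∉ S` and the allowance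
probability is uniformly small, `π_S(x) = ∫ 1_S(x, X̂) (∫ |Ψ(x', X̂)|² dx') dX̂ ≤ p` for all `x`, then
`λ_max(γ_Ψ) = sup_{‖φ‖=1} ⟨φ, γ_Ψ φ⟩ ≤ N p` (`N = n + 1`). Sharp on number-fragmented states
(`p = max_j n_j / N`). [folklore] -/
theorem SoloInformed.maxOccupation_le_of_confined {Ψ : Config (n + 1) → ℂ} (hΨ : Measurable Ψ)
    {S : Set (Space × Config n)} (hS : MeasurableSet S)
    (h0 : ∀ x Y, (x, Y) ∉ S → Ψ (Matrix.vecCons x Y) = 0) {p : ℝ≥0∞}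
    (hp : ∀ x, ∫⁻ Y : Config n, S.indicator (1 : Space × Config n → ℝ≥0∞) (x, Y) *
      ∫⁻ x', (‖Ψ (Matrix.vecCons x' Y)‖₊ : ℝ≥0∞) ^ 2 ≤ p) :
    maxOccupation (n + 1) Ψ ≤ (n + 1 : ℝ≥0∞) * p := by
  simp only [maxOccupation, iSup_le_iff]
  intro φ hφ
  calc occupation (n + 1) φ Ψ
      ≤ (n + 1 : ℝ≥0∞) * ∫⁻ x, (‖φ x‖₊ : ℝ≥0∞) ^ 2 *
          ∫⁻ Y : Config n, S.indicator (1 : Space × Config n → ℝ≥0∞) (x, Y) *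
            ∫⁻ x', (‖Ψ (Matrix.vecCons x' Y)‖₊ : ℝ≥0∞) ^ 2 :=
        SoloInformed.occupation_le_of_confined hΨ hS h0 hφ.1
    _ ≤ (n + 1 : ℝ≥0∞) * ∫⁻ x, (‖φ x‖₊ : ℝ≥0∞) ^ 2 * p := by
        gcongr with x
        exact hp x
    _ = (n + 1 : ℝ≥0∞) * p := by
        rw [lintegral_mul_const'' _ (hφ.1.aemeasurable.nnnorm.coe_nnreal_ennreal.pow_const 2),
          hφ.2, one_mul]

/-- **Confined near-minimisers have no macroscopic condensate number beyond `N p`.** If for every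
energy slack `δ > 0` some `δ`-near-minimiser in `Λ_L` is conditionally confined with allowance
probability `≤ p`, then `condensateNumber v N L ≤ N p`. (How rigidity of the ground state — e.g. a
crystalline or number-fragmented ground state — rules out BEC in the formalism of the conjunct.)
[folklore] -/
theorem SoloInformed.condensateNumber_le_of_confined (v : ℝ → ℝ≥0∞) (L : ℝ) {p : ℝ≥0∞}
    (h : ∀ δ : ℝ≥0∞, 0 < δ → ∃ Ψ : TrialState (n + 1) L,
      energy v Ψ ≤ groundStateEnergy v (n + 1) L + δ ∧
      ∃ S : Set (Space × Config n), MeasurableSet S ∧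
        (∀ x Y, (x, Y) ∉ S → Ψ.ψ (Matrix.vecCons x Y) = 0) ∧
        ∀ x, ∫⁻ Y : Config n, S.indicator (1 : Space × Config n → ℝ≥0∞) (x, Y) *
          ∫⁻ x', (‖Ψ.ψ (Matrix.vecCons x' Y)‖₊ : ℝ≥0∞) ^ 2 ≤ p) :
    condensateNumber v (n + 1) L ≤ (n + 1 : ℝ≥0∞) * p := by
  simp only [condensateNumber, iSup_le_iff]
  intro δ hδ
  obtain ⟨Ψ, hΨE, S, hS, h0, hp⟩ := h δ hδ
  exact (iInf_maxOccupation_le v Ψ hΨE).trans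
    (SoloInformed.maxOccupation_le_of_confined Ψ.contDiff.continuous.measurable hS h0 hp)

/-- **Asymptotic rigidity excludes BEC** (the obstruction in the conjunct's own terms). If, along
`N = n + 1 → ∞` in the boxes `Λ_{L_N}`, `L_N = (N/ρ)^{1/3}`, for every energy slack some
near-minimiser is conditionally confined with allowance probability `≤ p_N` and `p_N → 0`, then the
ground state does NOT Bose–Einstein condense at density `ρ`: `λ_max(γ_{Ψ₀}) ≤ p_N N = o(N)`. Any proof
of `BoseEinsteinCondensation` must therefore exclude such rigidity of the dilute ground state
uniformly in the volume. [folklore] -/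
theorem SoloInformed.not_hasGroundStateBEC_of_confined (v : ℝ → ℝ≥0∞) (ρ : ℝ) (p : ℕ → ℝ≥0)
    (hp : Tendsto p atTop (nhds 0))
    (h : ∀ᶠ n : ℕ in atTop, ∀ δ : ℝ≥0∞, 0 < δ →
      ∃ Ψ : TrialState (n + 1) (sideLength ρ (n + 1)),
        energy v Ψ ≤ groundStateEnergy v (n + 1) (sideLength ρ (n + 1)) + δ ∧
        ∃ S : Set (Space × Config n), MeasurableSet S ∧
          (∀ x Y, (x, Y) ∉ S → Ψ.ψ (Matrix.vecCons x Y) = 0) ∧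
          ∀ x, ∫⁻ Y : Config n, S.indicator (1 : Space × Config n → ℝ≥0∞) (x, Y) *
            ∫⁻ x', (‖Ψ.ψ (Matrix.vecCons x' Y)‖₊ : ℝ≥0∞) ^ 2 ≤ (p (n + 1) : ℝ≥0∞)) :
    ¬ HasGroundStateBEC v ρ := by
  rintro ⟨c, hc, hN⟩
  have hN' : ∀ᶠ n : ℕ in atTop, ENNReal.ofReal (c * ((n + 1 : ℕ) : ℝ)) ≤
      condensateNumber v (n + 1) (sideLength ρ (n + 1)) :=
    (tendsto_add_atTop_nat 1).eventually hN
  have hpc : ∀ᶠ n : ℕ in atTop, p (n + 1) < c.toNNReal :=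
    (tendsto_add_atTop_nat 1).eventually (hp.eventually_lt_const (Real.toNNReal_pos.2 hc))
  obtain ⟨n, h1, h2, h3⟩ := (h.and (hN'.and hpc)).exists
  have hle : condensateNumber v (n + 1) (sideLength ρ (n + 1)) ≤ (n + 1 : ℝ≥0∞) * p (n + 1) :=
    SoloInformed.condensateNumber_le_of_confined v _ h1
  have hlt : (n + 1 : ℝ≥0∞) * p (n + 1) < ENNReal.ofReal (c * ((n + 1 : ℕ) : ℝ)) := by
    rw [ENNReal.ofReal_mul hc.le, ENNReal.ofReal_natCast, mul_comm (ENNReal.ofReal c)]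
    push_cast
    have h0 : (n + 1 : ℝ≥0∞) ≠ 0 := by positivity
    have ht : (n + 1 : ℝ≥0∞) ≠ ⊤ := by exact_mod_cast ENNReal.natCast_ne_top (n + 1)
    exact ENNReal.mul_lt_mul_right h0 ht (ENNReal.coe_lt_coe.2 h3)
  exact absurd (h2.trans hle) (not_le.2 hlt)

end Summit.AtomisticToContinuum.BoseEinsteinCondensation.Theorems

end
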